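/-
Copyright: the b2b-balaban T⁴-continuum CRUX team, row NE7b leaf lineage `t4-ne7b-formalise-leaf-01` (gen 83). Project licence.
-/
import Mathlib.Algebra.Order.Chebyshev
import Mathlib.Analysis.SpecialFunctions.Exp
import Mathlib.Algebra.BigOperators.Intervals
import Mathlib.Data.Matrix.Mul

/-!
# POWER COUNTING IN POSITION SPACE: a symmetric lattice kernel's quadratic form is «ROW MASS × squares − ½·kernel × squared
# differences» — the mass term IS the row sum, the position-space Ward identity (zero row sums) kills it, and what is left is a
# pure difference form, bounded on a one-dimensional window by a first-moment straddling letter `W` times the MAIN Dirichlet form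
# (row NE7b, node U5c; kernel lemmas of finite sums)

Cell `pub-balaban`, sub-cell `t4`, spine estimate NE7b (`T4WeightBudget.RelWeightBound`; the cell's OWN estimate — NOT PRINTED in
[Bałaban 1983–89], NOT PROVED).  Crux-route work under `Spine/NE7b/` by a row leaf on the windowed convexity road (R-P1); NOTHING of
Bałaban's is named as a Lean object, valued or asserted; no `T4Continuum/Support` leaf typed; no `def`; zero `sorry`.  Imports: Mathlib
only — independent of the hub's olean frontier.

WHY.  The siblings `…InheritedHessianPowerCounting` (IHPC) and `…LatticeKernelMoments` (LKM) type the refuter's R-AHL-g83-1 (c) in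
MOMENTUM: no mass term + evenness make an inherited kernel marginal, subtraction makes it irrelevant.  The road's sockets, however, are
stated in POSITION space on windows (`…ConvexWindowSuppliers.firstOrderOn_quadratic_add_of_hessianOn`: `∀ x ∈ K, ∀ v, −h‖v‖² ≤ D²P(x)[v,v]`;
`…HessianLocality`: per-term local letters).  THIS FILE is the position-space face of the marginal statement, with no Fourier analysis:
for a symmetric kernel `K` on a finite index set the quadratic form is EXACTLY `Σ_x (Σ_y K x y)·v_x² − ½·Σ_{x,y} K x y·(v_x − v_y)²` —
the coefficient of `v_x²`, the MASS TERM, is the row sum `Σ_y K x y`; the Ward identity «`K` annihilates constants» is «zero row sums»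
and leaves a pure DIFFERENCE form; and on a one-dimensional window a difference form is bounded by the main DIRICHLET form
`Σ_i (v_{i+1} − v_i)²` times the straddling letter `W = sup_i Σ_{x ≤ i < y} |K x y|·(y − x)` — a first-moment-weighted sum, volume-free,
finite under a decay of `K` (the second moment `M·Σ_z z²e^{−κz}` in shape).  «Marginal» reads: bounded by a CONSTANT times the main form.

WHAT IS PROVED ([folklore]; finite sums, Mathlib's `sq_sum_le_card_mul_sum_sq` and `Finset.sum_range_sub` BY NAME):
* §1 ANY FINITE INDEX SET (`S : Finset ι`, `K : ι → ι → ℝ` symmetric ON `S`, `v : ι → ℝ`): **`form_eq_rowMass_sub_half_diff`**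
  (`Σ_{x,y∈S} K x y·v_x·v_y = Σ_{x∈S} (Σ_{y∈S} K x y)·v_x² − ½·Σ_{x,y∈S} K x y·(v_x − v_y)²`), `form_eq_neg_half_diff_of_rowSum_zero`
  (zero row sums ⟹ the pure difference form), **`abs_form_le_of_rowSum_zero`** (`|Q(v)| ≤ ½·Σ_{x,y} |K x y|·(v_x − v_y)²`),
  `form_const_eq_zero_of_rowSum_zero` (constants are zero modes — the Ward identity as a statement about the form); matrix currency
  (`Fintype ι`, `K` a symmetric `Matrix`): `dotProduct_mulVec_eq_rowMass_sub_half_diff` (`v ⬝ᵥ K *ᵥ v = …`), `abs_dotProduct_mulVec_le_of_rowSum_zero`.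
* §2 ONE DIMENSION (`v : ℤ → ℝ`): `sq_sub_le_mul_sum_sq_diff` (`(v(x+m) − v(x))² ≤ m·Σ_{j<m} (v(x+j+1) − v(x+j))²`, telescoping +
  Cauchy–Schwarz), `sum_sq_diff_shift_le` (that path sum is a sub-sum of the window's Dirichlet form when the path stays in the window).
* §3 THE STRADDLING LETTER (`S ⊆ Icc a b`, `K` symmetric with zero diagonal weight irrelevant): **`sum_abs_mul_sq_sub_le_dirichlet`** — if
  for every bond `i ∈ Ico a b` the straddling first moment `Σ_{x∈S} Σ_{y∈S, x ≤ i < y} |K x y|·(y − x) ≤ W`, then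
  `Σ_{x,y∈S} |K x y|·(v_x − v_y)² ≤ 2W·Σ_{i∈Ico a b} (v_{i+1} − v_i)²`; whence **`abs_form_le_dirichlet_of_rowSum_zero`**:
  `|Σ_{x,y∈S} K x y·v_x·v_y| ≤ W·Σ_{i∈Ico a b} (v_{i+1} − v_i)²` — the inherited form is MARGINAL: a constant times the main Dirichlet form;
  `dirichlet_le_four_mul_sum_sq` + `abs_form_le_mul_sum_sq_of_rowSum_zero` restate it in the road's `ℓ²` currency (`h = 4W`, `‖v‖²` on the window);
  **`straddle_le_of_decay`**: under `|K x y| ≤ Me^{−κ|y−x|}` the letter is `W = M·e^{−κ}·(Σ'_{n∈ℕ}(n+1)e^{−κn})²` at EVERY bond (volume- and window-free).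
* §4 toy: the path-graph Laplacian kernel on `{0, 1}` (`K 0 0 = K 1 1 = −1`, `K 0 1 = K 1 0 = 1`) has zero row sums and form
  `−(v₀ − v₁)²` (`pathLaplacian_form`).

NOT HERE (honest): the SUBTRACTED (fourth-order) position-space statement (a kernel annihilating constants AND matching the second
moment is bounded by a fourth-moment letter times `Σ_i (v_{i+1} − 2v_i + v_{i−1})²` — the discrete Peano kernel; not typed), `d > 1`
windows (paths along coordinate axes; the same straddling count per axis), the sharp value `M·Σ_{z≥1} z²e^{−κz}` of the straddling letter
(§3 proves the cruder factorised `M e^{−κ}(Σ(n+1)e^{−κn})²`), operator-valued kernels, and anything of Bałaban's (which kernels, which `(M, κ)`: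
[B12] (1.18) read BY SHAPE only).  BY-NAME EFFECT ON THE WALL: NONE (a position-space supplier for the road's displayed Hessian letters).
NE7b NOT PRINTED ∕ NOT PROVED; spine PROVED 0∕9; rung (B)+1 on a FINITE torus — NOT infinite volume, NOT the mass gap, NOT Clay.  HONEST
DEPENDENCY: continuum YM on T⁴ ⇐ BetaPertH ∧ nine spine estimates (0∕9 proved); BetaPertH ⇐ (D1) ∧ (D4) ∧ CAP+tail; G-an2-4 gates asym,
D1 and NE2∕3∕4.
-/

namespace Summit.QuantumFields.BalabanUV.T4Continuum.NE7b.WardKernelDifferenceForm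

open Finset
open scoped Matrix

/-! ## §1 Any finite index set: the mass term is the row sum -/

section General

variable {ι : Type*} {S : Finset ι} {K : ι → ι → ℝ} {v : ι → ℝ}

/-- **THE MASS TERM IS THE ROW SUM** [folklore]: for a kernel symmetric on `S`,
`Σ_{x,y∈S} K x y·v_x·v_y = Σ_{x∈S} (Σ_{y∈S} K x y)·v_x² − ½·Σ_{x,y∈S} K x y·(v_x − v_y)²`. -/
theorem form_eq_rowMass_sub_half_diff (hsym : ∀ x ∈ S, ∀ y ∈ S, K x y = K y x) (v : ι → ℝ) :
    ∑ x ∈ S, ∑ y ∈ S, K x y * v x * v y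
      = ∑ x ∈ S, (∑ y ∈ S, K x y) * v x ^ 2 - 1 / 2 * ∑ x ∈ S, ∑ y ∈ S, K x y * (v x - v y) ^ 2 := by
  have hsq : ∑ x ∈ S, ∑ y ∈ S, K x y * (v x - v y) ^ 2
      = 2 * ∑ x ∈ S, (∑ y ∈ S, K x y) * v x ^ 2 - 2 * ∑ x ∈ S, ∑ y ∈ S, K x y * v x * v y := by
    have e : ∀ x ∈ S, ∀ y ∈ S, K x y * (v x - v y) ^ 2
        = K x y * v x ^ 2 + K x y * v y ^ 2 - 2 * (K x y * v x * v y) := fun x _ y _ => by ring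
    rw [sum_congr rfl fun x hx => sum_congr rfl fun y hy => e x hx y hy]
    simp only [sum_sub_distrib, sum_add_distrib, ← mul_sum, ← sum_mul]
    have hswap : ∑ x ∈ S, ∑ y ∈ S, K x y * v y ^ 2 = ∑ x ∈ S, (∑ y ∈ S, K x y) * v x ^ 2 := by
      rw [sum_comm]
      refine sum_congr rfl fun y hy => ?_
      rw [sum_mul]
      exact sum_congr rfl fun x hx => by rw [hsym x hx y hy]
    rw [hswap]
    simp only [sum_mul]
    ring
  rw [hsq]; ring

/-- **ZERO ROW SUMS ⟹ A PURE DIFFERENCE FORM** [folklore]: if `K` annihilates constants on `S` (`Σ_{y∈S} K x y = 0` for `x ∈ S`, the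
position-space Ward identity), then `Σ_{x,y∈S} K x y·v_x·v_y = −½·Σ_{x,y∈S} K x y·(v_x − v_y)²` — no mass term. -/
theorem form_eq_neg_half_diff_of_rowSum_zero (hsym : ∀ x ∈ S, ∀ y ∈ S, K x y = K y x)
    (hrow : ∀ x ∈ S, ∑ y ∈ S, K x y = 0) (v : ι → ℝ) :
    ∑ x ∈ S, ∑ y ∈ S, K x y * v x * v y = -(1 / 2) * ∑ x ∈ S, ∑ y ∈ S, K x y * (v x - v y) ^ 2 := by
  rw [form_eq_rowMass_sub_half_diff hsym v, sum_congr rfl fun x hx => by rw [hrow x hx]]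
  simp

/-- **THE DIFFERENCE-FORM LETTER** [folklore]: zero row sums ⟹ `|Σ_{x,y∈S} K x y·v_x·v_y| ≤ ½·Σ_{x,y∈S} |K x y|·(v_x − v_y)²`. -/
theorem abs_form_le_of_rowSum_zero (hsym : ∀ x ∈ S, ∀ y ∈ S, K x y = K y x)
    (hrow : ∀ x ∈ S, ∑ y ∈ S, K x y = 0) (v : ι → ℝ) :
    |∑ x ∈ S, ∑ y ∈ S, K x y * v x * v y| ≤ 1 / 2 * ∑ x ∈ S, ∑ y ∈ S, |K x y| * (v x - v y) ^ 2 := by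
  rw [form_eq_neg_half_diff_of_rowSum_zero hsym hrow v, abs_mul, abs_neg, abs_of_pos (by norm_num : (0 : ℝ) < 1 / 2)]
  refine mul_le_mul_of_nonneg_left ((abs_sum_le_sum_abs _ _).trans (sum_le_sum fun x _ =>
    (abs_sum_le_sum_abs _ _).trans (sum_le_sum fun y _ => ?_))) (by norm_num)
  rw [abs_mul, abs_sq]

/-- **CONSTANTS ARE ZERO MODES** (the Ward identity as a statement about the form): zero row sums ⟹ the form vanishes on constant
fields. [folklore] -/
theorem form_const_eq_zero_of_rowSum_zero (hrow : ∀ x ∈ S, ∑ y ∈ S, K x y = 0) (c : ℝ) :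
    ∑ x ∈ S, ∑ y ∈ S, K x y * c * c = 0 :=
  sum_eq_zero fun x hx => by rw [← sum_mul, ← sum_mul, hrow x hx]; simp

/-- **MATRIX CURRENCY** (`ι` a `Fintype`, `S = univ`, `K` a symmetric matrix): `v ⬝ᵥ (K *ᵥ v) = Σ_x (Σ_y K x y)·v_x² − ½·Σ_{x,y} K x y·(v_x − v_y)²`
— the shape the road's `dotProduct` sockets (`…CoerciveFluctuationFloor.coercive_iff_inner`) read. [folklore] -/
theorem dotProduct_mulVec_eq_rowMass_sub_half_diff [Fintype ι] (K : Matrix ι ι ℝ) (hsym : ∀ x y, K x y = K y x) (v : ι → ℝ) :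
    v ⬝ᵥ (K *ᵥ v) = ∑ x, (∑ y, K x y) * v x ^ 2 - 1 / 2 * ∑ x, ∑ y, K x y * (v x - v y) ^ 2 := by
  have h := form_eq_rowMass_sub_half_diff (S := (univ : Finset ι)) (K := fun x y => K x y)
    (fun x _ y _ => hsym x y) v
  rw [← h]
  simp only [dotProduct, Matrix.mulVec, mul_sum]
  exact sum_congr rfl fun x _ => sum_congr rfl fun y _ => by ring

/-- Matrix currency, zero row sums: `v ⬝ᵥ (K *ᵥ v) = −½·Σ_{x,y} K x y·(v_x − v_y)²` and `|v ⬝ᵥ (K *ᵥ v)| ≤ ½·Σ_{x,y} |K x y|·(v_x − v_y)²`. [folklore] -/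
theorem abs_dotProduct_mulVec_le_of_rowSum_zero [Fintype ι] (K : Matrix ι ι ℝ) (hsym : ∀ x y, K x y = K y x)
    (hrow : ∀ x, ∑ y, K x y = 0) (v : ι → ℝ) :
    |v ⬝ᵥ (K *ᵥ v)| ≤ 1 / 2 * ∑ x, ∑ y, |K x y| * (v x - v y) ^ 2 := by
  have h := abs_form_le_of_rowSum_zero (S := (univ : Finset ι)) (K := fun x y => K x y)
    (fun x _ y _ => hsym x y) (fun x _ => hrow x) v
  have e : v ⬝ᵥ (K *ᵥ v) = ∑ x, ∑ y, K x y * v x * v y := by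
    simp only [dotProduct, Matrix.mulVec, mul_sum]
    exact sum_congr rfl fun x _ => sum_congr rfl fun y _ => by ring
  rw [e]; exact h

end General

/-! ## §2 One dimension: a squared difference is at most the length times the Dirichlet form along the path -/

/-- **TELESCOPING + CAUCHY–SCHWARZ** [folklore]: `(v(x+m) − v(x))² ≤ m·Σ_{j<m} (v(x+j+1) − v(x+j))²`. -/
theorem sq_sub_le_mul_sum_sq_diff (v : ℤ → ℝ) (x : ℤ) (m : ℕ) :
    (v (x + m) - v x) ^ 2 ≤ m * ∑ j ∈ range m, (v (x + j + 1) - v (x + j)) ^ 2 := by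
  have htel : v (x + m) - v x = ∑ j ∈ range m, (v (x + j + 1) - v (x + j)) := by
    have h := Finset.sum_range_sub (fun j : ℕ => v (x + j)) m
    simp only [Nat.cast_add, Nat.cast_one, ← add_assoc, Nat.cast_zero, add_zero] at h
    rw [← h]
  rw [htel]
  have h := sq_sum_le_card_mul_sum_sq (s := range m) (f := fun j => v (x + j + 1) - v (x + j))
  rwa [card_range] at h

/-- The path's Dirichlet sum is a sub-sum of the window's when the path `x, x+1, …, x+m` stays inside `Ico a b ∋` its bonds:
`Σ_{j<m} (v(x+j+1) − v(x+j))² ≤ Σ_{i∈Ico a b} (v(i+1) − v(i))²` for `a ≤ x` and `x + m ≤ b`. [folklore] -/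
theorem sum_sq_diff_shift_le (v : ℤ → ℝ) {a b x : ℤ} {m : ℕ} (hax : a ≤ x) (hxb : x + m ≤ b) :
    ∑ j ∈ range m, (v (x + j + 1) - v (x + j)) ^ 2 ≤ ∑ i ∈ Ico a b, (v (i + 1) - v i) ^ 2 := by
  have hinj : Set.InjOn (fun j : ℕ => x + j) (range m : Set ℕ) := fun j _ j' _ h => by
    simpa using h
  calc ∑ j ∈ range m, (v (x + j + 1) - v (x + j)) ^ 2
      = ∑ i ∈ (range m).image (fun j : ℕ => x + j), (v (i + 1) - v i) ^ 2 := by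
        rw [sum_image hinj]
    _ ≤ ∑ i ∈ Ico a b, (v (i + 1) - v i) ^ 2 := by
        refine sum_le_sum_of_subset_of_nonneg ?_ fun i _ _ => sq_nonneg _
        intro i hi
        simp only [mem_image, mem_range] at hi
        obtain ⟨j, hj, rfl⟩ := hi
        simp only [mem_Ico]
        constructor <;> omega

/-- The two combined: for integers `x ≤ y` inside the window (`a ≤ x`, `y ≤ b`),
`(v y − v x)² ≤ (y − x)·Σ_{i∈Ico a b} (v(i+1) − v(i))²`. [folklore] -/
theorem sq_sub_le_mul_dirichlet (v : ℤ → ℝ) {a b x y : ℤ} (hax : a ≤ x) (hxy : x ≤ y) (hyb : y ≤ b) :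
    (v y - v x) ^ 2 ≤ (y - x) * ∑ i ∈ Ico a b, (v (i + 1) - v i) ^ 2 := by
  obtain ⟨m, rfl⟩ := Int.le.dest hxy
  have h1 := sq_sub_le_mul_sum_sq_diff v x m
  have h2 := sum_sq_diff_shift_le v hax (m := m) hyb
  calc (v (x + m) - v x) ^ 2 ≤ m * ∑ j ∈ range m, (v (x + j + 1) - v (x + j)) ^ 2 := h1
    _ ≤ m * ∑ i ∈ Ico a b, (v (i + 1) - v i) ^ 2 := by gcongr
    _ = _ := by push_cast; ring

/-! ## §3 The straddling letter: the difference form is bounded by `W` times the main Dirichlet form -/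

/-- **STRADDLING RE-SUMMATION** [folklore bookkeeping]: with `S ⊆ Icc a b`, non-negative weights `w` and bond energies `g`,
`Σ_{x∈S} Σ_{y∈S, x<y} w x y·Σ_{i∈Ico x y} g i = Σ_{i∈Ico a b} g i·Σ_{x∈S} Σ_{y∈S} [x ≤ i < y]·w x y` — every pair pays each bond it
straddles. -/
theorem sum_straddle_eq (S : Finset ℤ) {a b : ℤ} (hS : S ⊆ Icc a b) (w : ℤ → ℤ → ℝ) (g : ℤ → ℝ) :
    ∑ x ∈ S, ∑ y ∈ S, (if x < y then w x y * ∑ i ∈ Ico x y, g i else 0)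
      = ∑ i ∈ Ico a b, g i * ∑ x ∈ S, ∑ y ∈ S, (if x ≤ i ∧ i < y then w x y else 0) := by
  have hIco : ∀ x ∈ S, ∀ y ∈ S, ∑ i ∈ Ico x y, g i = ∑ i ∈ Ico a b, (if x ≤ i ∧ i < y then g i else 0) := by
    intro x hx y hy
    have hxa : a ≤ x := (mem_Icc.1 (hS hx)).1
    have hyb : y ≤ b := (mem_Icc.1 (hS hy)).2
    rw [← sum_filter]
    congr 1
    ext i
    simp only [mem_Ico, mem_filter]
    constructor
    · rintro ⟨h1, h2⟩; exact ⟨⟨le_trans hxa h1, lt_of_lt_of_le h2 hyb⟩, h1, h2⟩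
    · rintro ⟨-, h1, h2⟩; exact ⟨h1, h2⟩
  have step1 : ∑ x ∈ S, ∑ y ∈ S, (if x < y then w x y * ∑ i ∈ Ico x y, g i else 0)
      = ∑ x ∈ S, ∑ y ∈ S, ∑ i ∈ Ico a b, (if x ≤ i ∧ i < y then w x y * g i else 0) := by
    refine sum_congr rfl fun x hx => sum_congr rfl fun y hy => ?_
    split_ifs with hxy
    · rw [hIco x hx y hy, mul_sum]
      refine sum_congr rfl fun i _ => ?_
      split_ifs <;> simp
    · symm
      refine sum_eq_zero fun i _ => ?_
      rw [if_neg]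
      rintro ⟨h1, h2⟩
      exact hxy (lt_of_le_of_lt h1 h2)
  rw [step1]
  simp_rw [Finset.sum_comm (s := S) (t := Ico a b)]
  refine sum_congr rfl fun i _ => ?_
  rw [mul_sum]
  refine sum_congr rfl fun x _ => ?_
  rw [mul_sum]
  refine sum_congr rfl fun y _ => ?_
  split_ifs <;> simp [mul_comm]

/-- **THE DIFFERENCE FORM IS BOUNDED BY THE STRADDLING LETTER TIMES THE DIRICHLET FORM** [folklore]: `S ⊆ Icc a b`, and for every bond
`i ∈ Ico a b` the straddling first moment `Σ_{x∈S} Σ_{y∈S} [x ≤ i < y]·|K x y|·(y − x) ≤ W`; then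
`Σ_{x,y∈S} |K x y|·(v_x − v_y)² ≤ 2W·Σ_{i∈Ico a b} (v_{i+1} − v_i)²` (`K` symmetric in absolute value on `S`). -/
theorem sum_abs_mul_sq_sub_le_dirichlet {S : Finset ℤ} {a b : ℤ} (hS : S ⊆ Icc a b) {K : ℤ → ℤ → ℝ}
    (hsym : ∀ x ∈ S, ∀ y ∈ S, |K x y| = |K y x|) {W : ℝ}
    (hW : ∀ i ∈ Ico a b, ∑ x ∈ S, ∑ y ∈ S, (if x ≤ i ∧ i < y then |K x y| * (y - x) else 0) ≤ W) (v : ℤ → ℝ) :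
    ∑ x ∈ S, ∑ y ∈ S, |K x y| * (v x - v y) ^ 2 ≤ 2 * W * ∑ i ∈ Ico a b, (v (i + 1) - v i) ^ 2 := by
  set D := ∑ i ∈ Ico a b, (v (i + 1) - v i) ^ 2 with hD
  have hD0 : 0 ≤ D := sum_nonneg fun i _ => sq_nonneg _
  -- the upper triangle `x < y`
  have hupper : ∑ x ∈ S, ∑ y ∈ S, (if x < y then |K x y| * (v x - v y) ^ 2 else 0) ≤ W * D := by
    calc ∑ x ∈ S, ∑ y ∈ S, (if x < y then |K x y| * (v x - v y) ^ 2 else 0)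
        ≤ ∑ x ∈ S, ∑ y ∈ S, (if x < y then (|K x y| * (y - x)) * ∑ i ∈ Ico x y, (v (i + 1) - v i) ^ 2 else 0) := by
          refine sum_le_sum fun x hx => sum_le_sum fun y hy => ?_
          split_ifs with hxy
          · have hxa : a ≤ x := (mem_Icc.1 (hS hx)).1
            have hyb : y ≤ b := (mem_Icc.1 (hS hy)).2
            have h := sq_sub_le_mul_dirichlet v (le_refl x) hxy.le (le_refl y)
            rw [show (v x - v y) ^ 2 = (v y - v x) ^ 2 by ring, mul_assoc]
            exact mul_le_mul_of_nonneg_left h (abs_nonneg _)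
          · exact le_rfl
      _ = ∑ i ∈ Ico a b, (v (i + 1) - v i) ^ 2
            * ∑ x ∈ S, ∑ y ∈ S, (if x ≤ i ∧ i < y then |K x y| * (y - x) else 0) :=
          sum_straddle_eq S hS (fun x y => |K x y| * (y - x)) fun i => (v (i + 1) - v i) ^ 2
      _ ≤ ∑ i ∈ Ico a b, (v (i + 1) - v i) ^ 2 * W :=
          sum_le_sum fun i hi => mul_le_mul_of_nonneg_left (hW i hi) (sq_nonneg _)
      _ = W * D := by rw [← sum_mul, mul_comm]
  -- the lower triangle equals the upper one by symmetry; the diagonal vanishes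
  have hsplit : ∑ x ∈ S, ∑ y ∈ S, |K x y| * (v x - v y) ^ 2
      = 2 * ∑ x ∈ S, ∑ y ∈ S, (if x < y then |K x y| * (v x - v y) ^ 2 else 0) := by
    have e : ∀ x ∈ S, ∀ y ∈ S, |K x y| * (v x - v y) ^ 2
        = (if x < y then |K x y| * (v x - v y) ^ 2 else 0) + (if y < x then |K x y| * (v x - v y) ^ 2 else 0) := by
      intro x _ y _
      rcases lt_trichotomy x y with h | rfl | h
      · rw [if_pos h, if_neg (lt_asymm h), add_zero]
      · simp
      · rw [if_neg (lt_asymm h), if_pos h, zero_add]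
    rw [sum_congr rfl fun x hx => sum_congr rfl fun y hy => e x hx y hy]
    simp only [sum_add_distrib]
    have hlow : ∑ x ∈ S, ∑ y ∈ S, (if y < x then |K x y| * (v x - v y) ^ 2 else 0)
        = ∑ x ∈ S, ∑ y ∈ S, (if x < y then |K x y| * (v x - v y) ^ 2 else 0) := by
      rw [sum_comm]
      refine sum_congr rfl fun x hx => sum_congr rfl fun y hy => ?_
      split_ifs with h
      · rw [hsym y hy x hx]; ring
      · rfl
    rw [hlow]; ring
  rw [hsplit]
  nlinarith

/-- **MARGINAL, IN POSITION SPACE** [folklore]: a symmetric kernel with ZERO ROW SUMS on a one-dimensional window `S ⊆ Icc a b`, whose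
straddling first moment is `≤ W` at every bond, has `|Σ_{x,y∈S} K x y·v_x·v_y| ≤ W·Σ_{i∈Ico a b} (v_{i+1} − v_i)²` — a CONSTANT times the
main Dirichlet form, for every field `v` and every window (no volume factor). -/
theorem abs_form_le_dirichlet_of_rowSum_zero {S : Finset ℤ} {a b : ℤ} (hS : S ⊆ Icc a b) {K : ℤ → ℤ → ℝ}
    (hsym : ∀ x ∈ S, ∀ y ∈ S, K x y = K y x) (hrow : ∀ x ∈ S, ∑ y ∈ S, K x y = 0) {W : ℝ}
    (hW : ∀ i ∈ Ico a b, ∑ x ∈ S, ∑ y ∈ S, (if x ≤ i ∧ i < y then |K x y| * (y - x) else 0) ≤ W) (v : ℤ → ℝ) :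
    |∑ x ∈ S, ∑ y ∈ S, K x y * v x * v y| ≤ W * ∑ i ∈ Ico a b, (v (i + 1) - v i) ^ 2 := by
  have h1 := abs_form_le_of_rowSum_zero hsym hrow v
  have h2 := sum_abs_mul_sq_sub_le_dirichlet hS (fun x hx y hy => by rw [hsym x hx y hy]) hW v
  nlinarith

/-- The window's Dirichlet form is at most four times its `ℓ²` mass: `Σ_{i∈Ico a b} (v_{i+1} − v_i)² ≤ 4·Σ_{i∈Icc a b} v_i²`. [folklore] -/
theorem dirichlet_le_four_mul_sum_sq (v : ℤ → ℝ) (a b : ℤ) :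
    ∑ i ∈ Ico a b, (v (i + 1) - v i) ^ 2 ≤ 4 * ∑ i ∈ Icc a b, v i ^ 2 := by
  have h1 : ∑ i ∈ Ico a b, (v (i + 1) - v i) ^ 2 ≤ ∑ i ∈ Ico a b, (2 * v (i + 1) ^ 2 + 2 * v i ^ 2) :=
    sum_le_sum fun i _ => by nlinarith [sq_nonneg (v (i + 1) + v i)]
  have h2 : ∑ i ∈ Ico a b, v (i + 1) ^ 2 ≤ ∑ i ∈ Icc a b, v i ^ 2 := by
    have hinj : Set.InjOn (fun i : ℤ => i + 1) (Ico a b : Set ℤ) := fun i _ j _ h => by simpa using h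
    rw [← sum_image (g := fun i : ℤ => i + 1) (f := fun j => v j ^ 2) hinj]
    refine sum_le_sum_of_subset_of_nonneg (fun j hj => ?_) fun _ _ _ => sq_nonneg _
    simp only [mem_image, mem_Ico] at hj
    obtain ⟨i, ⟨hi1, hi2⟩, rfl⟩ := hj
    simp only [mem_Icc]; constructor <;> omega
  have h3 : ∑ i ∈ Ico a b, v i ^ 2 ≤ ∑ i ∈ Icc a b, v i ^ 2 :=
    sum_le_sum_of_subset_of_nonneg Ico_subset_Icc_self fun _ _ _ => sq_nonneg _
  rw [sum_add_distrib, ← mul_sum, ← mul_sum] at h1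
  linarith

/-- **IN THE ROAD's `ℓ²` CURRENCY** [folklore]: under the hypotheses of `abs_form_le_dirichlet_of_rowSum_zero` and `0 ≤ W`,
`|Σ_{x,y∈S} K x y·v_x·v_y| ≤ 4W·Σ_{i∈Icc a b} v_i²` — the Hessian-smallness letter `h = 4W` of a window socket stated with `‖v‖²`
(cruder than the Dirichlet form: the marginal information is thrown away, the letter is still volume-free). -/
theorem abs_form_le_mul_sum_sq_of_rowSum_zero {S : Finset ℤ} {a b : ℤ} (hS : S ⊆ Icc a b) {K : ℤ → ℤ → ℝ}
    (hsym : ∀ x ∈ S, ∀ y ∈ S, K x y = K y x) (hrow : ∀ x ∈ S, ∑ y ∈ S, K x y = 0) {W : ℝ} (hW0 : 0 ≤ W)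
    (hW : ∀ i ∈ Ico a b, ∑ x ∈ S, ∑ y ∈ S, (if x ≤ i ∧ i < y then |K x y| * (y - x) else 0) ≤ W) (v : ℤ → ℝ) :
    |∑ x ∈ S, ∑ y ∈ S, K x y * v x * v y| ≤ 4 * W * ∑ i ∈ Icc a b, v i ^ 2 := by
  have h1 := abs_form_le_dirichlet_of_rowSum_zero hS hsym hrow hW v
  have h2 := dirichlet_le_four_mul_sum_sq v a b
  nlinarith

/-- A finite sum of a non-negative `f : ℕ → ℝ` over an injective re-indexing is at most the full series. -/
theorem sum_toNat_le_tsum {f : ℕ → ℝ} (hf0 : ∀ n, 0 ≤ f n) (hfs : Summable f) (T : Finset ℤ) (φ : ℤ → ℤ)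
    (hφ : ∀ x ∈ T, 0 ≤ φ x) (hinj : Set.InjOn φ T) :
    ∑ x ∈ T, f (φ x).toNat ≤ ∑' n, f n := by
  have hinj' : Set.InjOn (fun x => (φ x).toNat) T := fun x hx y hy h => by
    have h' : φ x = φ y := by
      have := congrArg (fun n : ℕ => (n : ℤ)) h
      simpa [Int.toNat_of_nonneg (hφ x hx), Int.toNat_of_nonneg (hφ y hy)] using this
    exact hinj hx hy h'
  rw [← sum_image hinj']
  exact hfs.sum_le_tsum _ fun n _ => hf0 n

/-- **THE STRADDLING LETTER UNDER A DECAY** [folklore]: if `|K x y| ≤ M·e^{−κ|y−x|}` on `S` (`κ > 0`, `M ≥ 0`), then at every bond `i`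
`Σ_{x∈S} Σ_{y∈S} [x ≤ i < y]·|K x y|·(y − x) ≤ M·e^{−κ}·(Σ'_{n∈ℕ} (n+1)e^{−κn})²` — volume-free, window-free (via `u + t + 1 ≤ (u+1)(t+1)`
for the pair `x = i − u`, `y = i + 1 + t`; in shape the second moment `M·Σ_z z²e^{−κz}`). -/
theorem straddle_le_of_decay {S : Finset ℤ} {K : ℤ → ℤ → ℝ} {M κ : ℝ} (hκ : 0 < κ) (hM : 0 ≤ M)
    (hdecay : ∀ x ∈ S, ∀ y ∈ S, |K x y| ≤ M * Real.exp (-κ * |(y : ℝ) - x|)) (i : ℤ) :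
    ∑ x ∈ S, ∑ y ∈ S, (if x ≤ i ∧ i < y then |K x y| * (y - x) else 0)
      ≤ M * Real.exp (-κ) * (∑' n : ℕ, ((n : ℝ) + 1) * Real.exp (-κ * n)) ^ 2 := by
  set f : ℕ → ℝ := fun n => ((n : ℝ) + 1) * Real.exp (-κ * n) with hf
  have hf0 : ∀ n, 0 ≤ f n := fun n => by positivity
  have hfs : Summable f := by
    have h1 := Real.summable_pow_mul_exp_neg_nat_mul 1 hκ
    have h0 := Real.summable_pow_mul_exp_neg_nat_mul 0 hκ
    simpa [hf, add_mul] using h1.add h0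
  -- termwise factorisation
  have hterm : ∀ x ∈ S, ∀ y ∈ S, (if x ≤ i ∧ i < y then |K x y| * (y - x) else 0)
      ≤ (if x ≤ i then M * Real.exp (-κ) * f (i - x).toNat else 0) * (if i < y then f (y - i - 1).toNat else 0) := by
    intro x hx y hy
    by_cases hxi : x ≤ i
    · by_cases hiy : i < y
      · rw [if_pos ⟨hxi, hiy⟩, if_pos hxi, if_pos hiy]
        have hu : (((i - x).toNat : ℕ) : ℝ) = (i : ℝ) - x := by
          have := Int.toNat_of_nonneg (sub_nonneg.2 hxi); exact_mod_cast this
        have ht : (((y - i - 1).toNat : ℕ) : ℝ) = (y : ℝ) - i - 1 := by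
          have := Int.toNat_of_nonneg (show (0 : ℤ) ≤ y - i - 1 by omega); exact_mod_cast this
        have hyx : |(y : ℝ) - x| = (y : ℝ) - x := abs_of_pos (by
          have : (x : ℝ) < y := by exact_mod_cast (lt_of_le_of_lt hxi hiy)
          linarith)
        have hK := hdecay x hx y hy
        rw [hyx] at hK
        have hexp : Real.exp (-κ * ((y : ℝ) - x))
            = Real.exp (-κ) * (Real.exp (-κ * ((i : ℝ) - x)) * Real.exp (-κ * ((y : ℝ) - i - 1))) := by
          rw [← Real.exp_add, ← Real.exp_add]; congr 1; ring
        have hprod : (y : ℝ) - x ≤ ((i : ℝ) - x + 1) * ((y : ℝ) - i - 1 + 1) := by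
          have h1 : (0 : ℝ) ≤ (i : ℝ) - x := by exact_mod_cast sub_nonneg.2 hxi
          have h2 : (0 : ℝ) ≤ (y : ℝ) - i - 1 := by
            have : i + 1 ≤ y := hiy
            have : ((i : ℝ) + 1 ≤ y) := by exact_mod_cast this
            linarith
          nlinarith
        simp only [hf, hu, ht]
        calc |K x y| * ((y : ℝ) - x) ≤ M * Real.exp (-κ * ((y : ℝ) - x)) * (((i : ℝ) - x + 1) * ((y : ℝ) - i - 1 + 1)) := by
              apply mul_le_mul hK hprod (by
                have : (x : ℝ) < y := by exact_mod_cast (lt_of_le_of_lt hxi hiy)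
                linarith) (by positivity)
          _ = M * Real.exp (-κ) * (((i : ℝ) - x + 1) * Real.exp (-κ * ((i : ℝ) - x)))
              * (((y : ℝ) - i - 1 + 1) * Real.exp (-κ * ((y : ℝ) - i - 1))) := by rw [hexp]; ring
      · rw [if_neg (fun h => hiy h.2), if_neg hiy, mul_zero]
    · rw [if_neg (fun h => hxi h.1), if_neg hxi, zero_mul]
  have hA : ∑ x ∈ S, (if x ≤ i then M * Real.exp (-κ) * f (i - x).toNat else 0)
      ≤ M * Real.exp (-κ) * ∑' n, f n := by
    rw [← sum_filter, ← mul_sum]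
    refine mul_le_mul_of_nonneg_left ?_ (by positivity)
    exact sum_toNat_le_tsum hf0 hfs _ (fun x => i - x) (fun x hx => sub_nonneg.2 (mem_filter.1 hx).2)
      fun x _ y _ h => by simpa using h
  have hB : ∑ y ∈ S, (if i < y then f (y - i - 1).toNat else 0) ≤ ∑' n, f n := by
    rw [← sum_filter]
    exact sum_toNat_le_tsum hf0 hfs _ (fun y => y - i - 1) (fun y hy => by have := (mem_filter.1 hy).2; omega)
      fun x _ y _ h => by simpa using h
  have hB0 : 0 ≤ ∑ y ∈ S, (if i < y then f (y - i - 1).toNat else 0) :=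
    sum_nonneg fun y _ => by split_ifs <;> simp [hf0]
  have hT0 : 0 ≤ ∑' n, f n := tsum_nonneg hf0
  calc ∑ x ∈ S, ∑ y ∈ S, (if x ≤ i ∧ i < y then |K x y| * (y - x) else 0)
      ≤ ∑ x ∈ S, ∑ y ∈ S, (if x ≤ i then M * Real.exp (-κ) * f (i - x).toNat else 0)
          * (if i < y then f (y - i - 1).toNat else 0) :=
        sum_le_sum fun x hx => sum_le_sum fun y hy => hterm x hx y hy
    _ = (∑ x ∈ S, (if x ≤ i then M * Real.exp (-κ) * f (i - x).toNat else 0))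
          * ∑ y ∈ S, (if i < y then f (y - i - 1).toNat else 0) := by rw [sum_mul_sum]
    _ ≤ (M * Real.exp (-κ) * ∑' n, f n) * ∑' n, f n :=
        mul_le_mul hA hB hB0 (by positivity)
    _ = M * Real.exp (-κ) * (∑' n, f n) ^ 2 := by ring

/-! ## §4 Toy: the path-graph Laplacian on two sites -/

/-- The two-site Laplacian kernel (`K 0 0 = K 1 1 = −1`, `K 0 1 = K 1 0 = 1`) has zero row sums and form `−(v 0 − v 1)²`. [folklore] -/
theorem pathLaplacian_form (v : ℤ → ℝ) :
    ∑ x ∈ ({0, 1} : Finset ℤ), ∑ y ∈ ({0, 1} : Finset ℤ), (if x = y then (-1 : ℝ) else 1) * v x * v y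
      = -(v 0 - v 1) ^ 2 := by
  simp [sum_insert, sum_singleton]
  ring

end Summit.QuantumFields.BalabanUV.T4Continuum.NE7b.WardKernelDifferenceForm
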